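/-
Copyright: the b2b-balaban T⁴-continuum CRUX team, row NE7b OWNER lineage `t4-ne7b-p1` (gen 122). Project licence.
-/
import Summits.QuantumFields.BalabanUV.T4Continuum.Spine.NE7b.SupTorusSupNormRoad
import Summits.QuantumFields.BalabanUV.T4Continuum.Spine.NE7b.SupTorusResponseOperatorLocality
import Summits.QuantumFields.BalabanUV.T4Continuum.Spine.NE7b.SupTorusPropagatorModulus

/-!
# THE ROAD'S LINEAR MAPS ARE BOUNDED ON `ℓ^∞`, MESH- AND VOLUME-FREE, ON THE ROAD'S CLASS `−λ ≤ V ≤ Λ` (`d ≥ 3` where `H_V⁻¹` enters): the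
# next-scale inverse `T⁻¹` (`‖T⁻¹k‖_∞ ≤ c₁K·‖k‖_∞`, every `d`), the road's response operator `Dt` (`‖Dt k‖_∞ ≤ C‖k‖_∞`), the fluctuation
# covariance (`‖u − Σ_{y′}(T⁻¹Q′tu)(y′)ψ_{y′}‖_∞ ≤ C‖f‖_∞` for EVERY source) and `H_V⁻¹` is LIPSCHITZ in `V` on `ℓ^∞`
# (`‖H_{V₁}⁻¹f − H_{V₂}⁻¹f‖_∞ ≤ C·‖V₁ − V₂‖_∞·‖f‖_∞`) — (152) `supNorm_bound_road` read on the sources `(Mt k)∘bt`, `(T⁻¹Q′tu)∘bt`,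
# `−(V₁ − V₂)u₂` ((135)∕(148)∕(150)∕(141) BY NAME) (row NE7b, node U5c; [folklore])

Cell `pub-balaban`, sub-cell `t4`, spine estimate NE7b (`T4WeightBudget.RelWeightBound`; the cell's OWN estimate — NOT PRINTED in
[Bałaban 1983–89], NOT PROVED).  Crux-route work under `Spine/NE7b/` by the row OWNER (`t4-ne7b-p1` gen 122, file (157)) under FREEZE
(0)'s crux-prover clause; NOTHING of Bałaban's is named as a Lean object, valued or asserted; no `T4Continuum/Support` leaf typed; no `def`,
no notation (the action and every operator DISPLAYED exactly as in (133)–(156)); zero `sorry`.  Imports (BY NAME): the OWNER's (152)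
`…SupTorusSupNormRoad` (`supNorm_bound_road`; through it (148) `exists_blockColumns`, `blockMean_le_sup`, (135) `nextScale_hessian_local`,
(133) `action_sum_smul`, (132) `isPseudoDist_torus`, `torus_sum_exp_le`, (131) `exists_rate`), (150) `…SupTorusResponseOperatorLocality`
(`response_eq_superposition`), (141) `…SupTorusPropagatorModulus` (`action_sub_of_potentials`).

WHY (located).  An iteration in the sup currency needs the step's linear maps bounded on `ℓ^∞` uniformly in mesh and volume (the sup road on
`ℤ^d` has `‖C̃(w)g‖ ≤ 2(N⁻¹ − c)⁻¹‖g‖`, (60)); on the torus `ℓ²` road, (148) gave `‖H_V⁻¹‖_{∞→∞}` on the strictly convex class only and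
(152) on the road's class.  Every other map of the road is `H_V⁻¹` of a BLOCK-CONSTANT source whose coefficients are `T⁻¹` of bounded
coarse data — `T⁻¹` has exponentially decaying entries ((135)), so `‖T⁻¹‖_{∞→∞} ≤ c₁K_{δ₁}` by (132) `torus_sum_exp_le` — or, for the
Lipschitz letter, of `−(V₁ − V₂)u₂` ((141)'s displayed resolvent identity); (152) finishes each time.

WHAT IS PROVED ([folklore]; fine torus `Site d ((n+1)s)`, coarse `Site d s`, `[NeZero s]`; the action DISPLAYED; `σ = siteOf`, `bt x =
σ_s(blk n (wm x))`; `T = Matrix.of (y,y″ ↦ (n+1)^{−d}Σ_z ψ_{y″}(σ(chart (wm y) z)))` for block columns `ψ`; `a > 0`, `λ < min(2,a)`, `Λ ≥ 0`):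
* §1 **`nextScale_inverse_supNorm`** (every `d`): `∃ C > 0`: ALL `n, s`, `−λ ≤ V ≤ Λ`, `ψ`, every `k` with `|k| ≤ M_k`, every `y`:
  `|Σ_{y′}T⁻¹(y,y′)k(y′)| ≤ C·M_k`.
* §2 **`response_operator_supNorm`** (`d ≥ 3`): for the road's operators ((150)'s quantifier prefix, `u′(φ ·) ∈ [−λ, Λ]`): `|(Dt k)(x)| ≤ C·M_k`.
* §3 **`covariance_supNorm`** (`d ≥ 3`): EVERY `f` with `|f| ≤ M`, `Hu = f` ⟹ `|u x − Σ_{y′}(Σ_{y″}T⁻¹(y′,y″)(n+1)^{−d}Σ_z u(σ(chart (wm y″) z)))ψ_{y′}(x)|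
  ≤ C·M` at every site (no support condition).
* §4 **`propagator_supNorm_lipschitz`** (`d ≥ 3`): `V₁, V₂ ∈ [−λ, Λ]`, `|V₁ − V₂| ≤ D`, `H_{V₁}u₁ = f = H_{V₂}u₂`, `|f| ≤ M` ⟹ `|u₁ x − u₂ x| ≤ C·D·M`.
* §5 toy (`d = 3`).

HONEST (what this is NOT).  By-name junctions; `d ≥ 3` wherever (152) enters; constants existential and far from sharp; cubic periods; scalar
skeleton ((A3), NC-NE7b-α UNRULED); the covariance OPERATOR of (100) (`A⁻¹∘inr` display) is not junctioned (§3 is its written-out form);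
nothing of the covariant propagators of [B4]–[B6]; nothing of Bałaban's.  BY-NAME EFFECT ON THE WALL: NONE.  NE7b NOT PRINTED ∕ NOT PROVED;
spine PROVED 0∕9; rung (B)+1 on a FINITE torus — NOT infinite volume, NOT the mass gap, NOT Clay.  HONEST DEPENDENCY: continuum YM on T⁴ ⇐
BetaPertH ∧ nine spine estimates (0∕9 proved); BetaPertH ⇐ (D1) ∧ (D4) ∧ CAP+tail; G-an2-4 gates asym, D1 and NE2∕3∕4.
-/

set_option autoImplicit false

noncomputable section

namespace Summit.QuantumFields.BalabanUV.T4Continuum.NE7b.SupTorusSupNormOperators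

open Real
open scoped ENNReal
open Literature.MathematicalPhysics.QuantumFieldTheory.Balaban1983to89
open B6QGQLower276 (X e blk B side AX chart mem_B sum_B sum_B_const card_cube blk_chart)
open B5Hk103ScalarZd (nbhd)
open Beta (Site siteOf windowMap siteOf_windowMap siteOf_add siteOf_sub)
open SupTorusHessianCombesThomas (exists_rate)
open SupTorusBlockDistance (isPseudoDist_torus torus_sum_exp_le)
open SupTorusActionForm (action_sum_smul)
open SupTorusCoarseFloor (nextScale_hessian_local)
open SupTorusSupNormBound (exists_blockColumns blockMean_le_sup)
open SupTorusSupNormRoad (supNorm_bound_road)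
open SupTorusResponseOperatorLocality (response_eq_superposition)
open SupTorusPropagatorModulus (action_sub_of_potentials)

variable {d : ℕ}

/-! ## §1. `T⁻¹` is bounded on `ℓ^∞` of the coarse torus -/

/-- **`‖T⁻¹‖_{ℓ^∞→ℓ^∞} ≤ c₁K_{δ₁}` ON THE ROAD'S CLASS, every mesh, every volume, every `d`**: `∃ C > 0` (from `(d, a, λ, Λ)`) such that for
ALL `n, s`, ALL `−λ ≤ V ≤ Λ`, ALL block columns `ψ`, every coarse `k` with `|k| ≤ M_k` and every `y`: `|Σ_{y′}T⁻¹(y,y′)k(y′)| ≤ C·M_k` — (135)'s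
entry decay summed with (132) `torus_sum_exp_le`. [folklore] -/
theorem nextScale_inverse_supNorm (a : ℝ) (ha : 0 < a) {lam Lam : ℝ} (hlam : lam < min 2 a) (hLam : 0 ≤ Lam) :
    ∃ C : ℝ, 0 < C ∧ ∀ (n s : ℕ) [NeZero s] (V : Site d ((n + 1) * s) → ℝ), (∀ x, -lam ≤ V x) → (∀ x, V x ≤ Lam) →
      ∀ ψ : Site d s → Site d ((n + 1) * s) → ℝ,
      (∀ y' x, ((n : ℝ) + 1) ^ 2 * ∑ μ, (2 * ψ y' x - ψ y' (x + siteOf d ((n + 1) * s) (e μ)) - ψ y' (x - siteOf d ((n + 1) * s) (e μ)))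
        + a / ((n : ℝ) + 1) ^ d * ∑ q ∈ B n (blk n (windowMap d ((n + 1) * s) x)), ψ y' (siteOf d ((n + 1) * s) q) + V x * ψ y' x
        = if siteOf d s (blk n (windowMap d ((n + 1) * s) x)) = y' then 1 else 0) →
      ∀ (k : Site d s → ℝ) (Mk : ℝ), (∀ y, |k y| ≤ Mk) → ∀ y : Site d s,
        |∑ y', (Matrix.of fun yy y'' : Site d s =>
            (((n : ℝ) + 1) ^ d)⁻¹ * ∑ z : Fin d → Fin (n + 1), ψ y'' (siteOf d ((n + 1) * s) (chart n (windowMap d s yy) z)))⁻¹ y y' * k y'|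
          ≤ C * Mk := by
  classical
  have hm0 : 0 < min 2 a - lam := by linarith
  obtain ⟨c₁, δ₁, hc₁, hδ₁, H135⟩ := nextScale_hessian_local (d := d) a ha hm0 hLam
  set K : ℝ := (2 * (1 - exp (-δ₁))⁻¹) ^ d with hK
  have hK0 : 0 < K := pow_pos (mul_pos two_pos (inv_pos.2 (sub_pos.2 (exp_lt_one_iff.2 (by linarith))))) d
  refine ⟨c₁ * K, by positivity, ?_⟩
  intro n s _ V hV hV' ψ hψ k Mk hk y
  set T : Matrix (Site d s) (Site d s) ℝ := Matrix.of fun yy y'' : Site d s =>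
    (((n : ℝ) + 1) ^ d)⁻¹ * ∑ z : Fin d → Fin (n + 1), ψ y'' (siteOf d ((n + 1) * s) (chart n (windowMap d s yy) z)) with hT_def
  have hMk : 0 ≤ Mk := (abs_nonneg _).trans (hk y)
  have hsum : ∑ y' : Site d s, exp (-(δ₁ * ∑ i, (((y i - y' i).valMinAbs.natAbs : ℕ) : ℝ))) ≤ K := torus_sum_exp_le (d := d) s hδ₁ y
  have hTinv : ∀ y' : Site d s, |T⁻¹ y y'| ≤ c₁ * exp (-(δ₁ * ∑ i, (((y i - y' i).valMinAbs.natAbs : ℕ) : ℝ))) :=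
    fun y' => H135 n s V hV hV' ψ hψ y y'
  have hterm : ∀ y' : Site d s, |T⁻¹ y y' * k y'| ≤ c₁ * Mk * exp (-(δ₁ * ∑ i, (((y i - y' i).valMinAbs.natAbs : ℕ) : ℝ))) :=
    fun y' => by
    rw [abs_mul]
    calc |T⁻¹ y y'| * |k y'| ≤ (c₁ * exp (-(δ₁ * ∑ i, (((y i - y' i).valMinAbs.natAbs : ℕ) : ℝ)))) * Mk :=
          mul_le_mul (hTinv y') (hk y') (abs_nonneg _) (by positivity)
      _ = _ := by ring
  have hfin : ∑ y' : Site d s, |T⁻¹ y y' * k y'| ≤ c₁ * Mk * K :=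
    calc ∑ y' : Site d s, |T⁻¹ y y' * k y'|
        ≤ ∑ y' : Site d s, c₁ * Mk * exp (-(δ₁ * ∑ i, (((y i - y' i).valMinAbs.natAbs : ℕ) : ℝ))) :=
          Finset.sum_le_sum fun y' _ => hterm y'
      _ = c₁ * Mk * ∑ y' : Site d s, exp (-(δ₁ * ∑ i, (((y i - y' i).valMinAbs.natAbs : ℕ) : ℝ))) := (Finset.mul_sum _ _ _).symm
      _ ≤ c₁ * Mk * K := mul_le_mul_of_nonneg_left hsum (by positivity)
  have hend : c₁ * Mk * K = c₁ * K * Mk := by ring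
  exact ((Finset.abs_sum_le_sum_abs _ _).trans hfin).trans hend.le

/-! ## §2. The road's response operator `Dt` is bounded on `ℓ^∞` -/

/-- **`‖Dt‖_{ℓ^∞→ℓ^∞} ≤ C` ON THE ROAD'S CLASS `u′(φ ·) ∈ [−λ, Λ]`, `d ≥ 3`, every mesh, every volume**, for the road's response OPERATOR `Dt` of (100)
((150)'s quantifier prefix): `Dt k = Σ_{y″}(Mt k)(y″)ψ_{y″}` with `Mt = T⁻¹` ((150) `response_eq_superposition`), `H(Dt k) = (Mt k)∘bt` ((133)
`action_sum_smul`), `|Mt k| ≤ c₁K·‖k‖_∞` (§1), and (152). [folklore] -/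
theorem response_operator_supNorm (hd : 3 ≤ d) (a : ℝ) (ha : 0 < a) {lam Lam : ℝ} (hlam : lam < min 2 a) (hLam : 0 ≤ Lam) :
    ∃ C : ℝ, 0 < C ∧ ∀ (n s : ℕ) [NeZero s]
      (Dop Aop : lp (fun _ : X d => ℝ) ∞ →L[ℝ] lp (fun _ : X d => ℝ) ∞),
      (∀ (f : lp (fun _ : X d => ℝ) ∞) (y : X d), Dop f y = (((n : ℝ) + 1) ^ d)⁻¹ * ∑ p ∈ B n y, f p) →
      (∀ (f : lp (fun _ : X d => ℝ) ∞) (p : X d), Aop f p = ∑ r ∈ nbhd n p, AX n a p r * f r) →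
      ∀ (Ef : (Site d ((n + 1) * s) → ℝ) →L[ℝ] lp (fun _ : X d => ℝ) ∞),
      (∀ (g : Site d ((n + 1) * s) → ℝ) (q : X d), Ef g q = g (siteOf d ((n + 1) * s) q)) →
      ∀ (Rf : lp (fun _ : X d => ℝ) ∞ →L[ℝ] (Site d ((n + 1) * s) → ℝ)),
      (∀ (h : lp (fun _ : X d => ℝ) ∞) (x : Site d ((n + 1) * s)), Rf h x = h (windowMap d ((n + 1) * s) x)) →
      ∀ (Rc : lp (fun _ : X d => ℝ) ∞ →L[ℝ] (Site d s → ℝ)),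
      (∀ (h : lp (fun _ : X d => ℝ) ∞) (x : Site d s), Rc h x = h (windowMap d s x)) →
      ∀ (u' : ℝ → ℝ) (φ : Site d ((n + 1) * s) → ℝ), (∀ x, -lam ≤ u' (φ x)) → (∀ x, u' (φ x) ≤ Lam) →
      ∀ (Dt : (Site d s → ℝ) →L[ℝ] (Site d ((n + 1) * s) → ℝ)),
      (∀ k : Site d s → ℝ, ((Rc.comp Dop).comp Ef) (Dt k) = k) →
      (∀ (k : Site d s → ℝ) (κ' : Site d ((n + 1) * s) → ℝ), ((Rc.comp Dop).comp Ef) κ' = 0 →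
        ∑ x, (((Rf.comp Aop).comp Ef) (Dt k) x + u' (φ x) * Dt k x) * κ' x = 0) →
      ∀ (Mt : (Site d s → ℝ) →L[ℝ] (Site d s → ℝ)),
      (∀ (k : Site d s → ℝ) (y : Site d s),
        Mt k y = ((Rc.comp Dop).comp Ef) (fun x => ((Rf.comp Aop).comp Ef) (Dt k) x + u' (φ x) * Dt k x) y) →
      ∀ (k : Site d s → ℝ) (Mk : ℝ), (∀ y, |k y| ≤ Mk) → ∀ x : Site d ((n + 1) * s), |Dt k x| ≤ C * Mk := by
  classical
  have hm0 : 0 < min 2 a - lam := by linarith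
  obtain ⟨C₁, hC₁, H1⟩ := nextScale_inverse_supNorm (d := d) a ha hlam hLam
  obtain ⟨C₀, hC₀, H0⟩ := supNorm_bound_road (d := d) hd a ha hlam hLam
  refine ⟨C₀ * C₁, by positivity, ?_⟩
  intro n s _ Dop Aop hD hA Ef hEf Rf hRf Rc hRc u' φ hu hu' Dt hDQ hDlin Mt hMt k Mk hk x
  obtain ⟨ψ, hψ, hsuper, hent⟩ := response_eq_superposition (d := d) a ha hm0 n s Dop Aop hD hA Ef hEf Rf hRf Rc hRc u' φ hu Dt hDQ hDlin Mt hMt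
  set T : Matrix (Site d s) (Site d s) ℝ := Matrix.of fun yy y'' : Site d s =>
    (((n : ℝ) + 1) ^ d)⁻¹ * ∑ z : Fin d → Fin (n + 1), ψ y'' (siteOf d ((n + 1) * s) (chart n (windowMap d s yy) z)) with hT_def
  -- `Mt k = Σ_{y′} k y′ · T⁻¹(·, y′)`
  have hksum : k = ∑ y' : Site d s, k y' • (fun y'' : Site d s => if y'' = y' then (1 : ℝ) else 0) := by
    funext y; simp [Finset.sum_apply]
  have hMk : ∀ y, Mt k y = ∑ y' : Site d s, T⁻¹ y y' * k y' := by
    intro y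
    conv_lhs => rw [hksum]
    rw [map_sum, Finset.sum_apply]
    exact Finset.sum_congr rfl fun y' _ => by rw [map_smul, Pi.smul_apply, smul_eq_mul, hent y y', mul_comm]
  have hMbound : ∀ y, |Mt k y| ≤ C₁ * Mk := fun y => by rw [hMk y]; exact H1 n s (fun x => u' (φ x)) hu hu' ψ hψ k Mk hk y
  -- `H(Dt k) = (Mt k)∘bt`
  have hDt : ∀ x', Dt k x' = ∑ y'' : Site d s, Mt k y'' * ψ y'' x' := fun x' => by rw [← hsuper k]
  have hH : ∀ x', ((n : ℝ) + 1) ^ 2 * ∑ μ, (2 * Dt k x' - Dt k (x' + siteOf d ((n + 1) * s) (e μ)) - Dt k (x' - siteOf d ((n + 1) * s) (e μ)))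
      + a / ((n : ℝ) + 1) ^ d * ∑ q ∈ B n (blk n (windowMap d ((n + 1) * s) x')), Dt k (siteOf d ((n + 1) * s) q) + u' (φ x') * Dt k x'
      = Mt k (siteOf d s (blk n (windowMap d ((n + 1) * s) x'))) := by
    intro x'
    simp only [hDt]
    rw [action_sum_smul n a s Finset.univ (fun y'' => Mt k y'') ψ (fun x => u' (φ x)) x']
    simp only [hψ, mul_ite, mul_one, mul_zero, Finset.sum_ite_eq, Finset.mem_univ, if_true]
  have h := H0 n s (fun x => u' (φ x)) hu hu' (C₁ * Mk) (fun x' => Dt k x') (fun x' => Mt k (siteOf d s (blk n (windowMap d ((n + 1) * s) x'))))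
    (fun x' => hMbound _) hH x
  linarith [h]

/-! ## §3. The fluctuation covariance is bounded on `ℓ^∞`, every source -/

/-- **`‖C‖_{ℓ^∞→ℓ^∞} ≤ C` ON THE ROAD'S CLASS, `d ≥ 3`, every mesh, every volume, EVERY source**: for block columns `ψ`, every `f` with `|f| ≤ M`
(no support condition) and `Hu = f`: `|u x − h x| ≤ C·M` with `h = Σ_{y′}c y′·ψ_{y′}`, `c = T⁻¹(Q′tu)` — `‖u‖_∞ ≤ C₀M` ((152)), block means of `u`
`≤ Cd·M` ((148) `blockMean_le_sup`), `|c| ≤ C₁Cd·M` (§1), `Hh = c∘bt` ((133)), `‖h‖_∞ ≤ C₀C₁Cd·M` ((152)). [folklore] -/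
theorem covariance_supNorm (hd : 3 ≤ d) (a : ℝ) (ha : 0 < a) {lam Lam : ℝ} (hlam : lam < min 2 a) (hLam : 0 ≤ Lam) :
    ∃ C : ℝ, 0 < C ∧ ∀ (n s : ℕ) [NeZero s] (V : Site d ((n + 1) * s) → ℝ), (∀ x, -lam ≤ V x) → (∀ x, V x ≤ Lam) →
      ∀ ψ : Site d s → Site d ((n + 1) * s) → ℝ,
      (∀ y' x, ((n : ℝ) + 1) ^ 2 * ∑ μ, (2 * ψ y' x - ψ y' (x + siteOf d ((n + 1) * s) (e μ)) - ψ y' (x - siteOf d ((n + 1) * s) (e μ)))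
        + a / ((n : ℝ) + 1) ^ d * ∑ q ∈ B n (blk n (windowMap d ((n + 1) * s) x)), ψ y' (siteOf d ((n + 1) * s) q) + V x * ψ y' x
        = if siteOf d s (blk n (windowMap d ((n + 1) * s) x)) = y' then 1 else 0) →
      ∀ (M : ℝ) (u f : Site d ((n + 1) * s) → ℝ), (∀ x, |f x| ≤ M) →
      (∀ x, ((n : ℝ) + 1) ^ 2 * ∑ μ, (2 * u x - u (x + siteOf d ((n + 1) * s) (e μ)) - u (x - siteOf d ((n + 1) * s) (e μ)))
        + a / ((n : ℝ) + 1) ^ d * ∑ q ∈ B n (blk n (windowMap d ((n + 1) * s) x)), u (siteOf d ((n + 1) * s) q) + V x * u x = f x) →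
      ∀ x : Site d ((n + 1) * s),
        |u x - ∑ y', (∑ y'', (Matrix.of fun yy y'' : Site d s =>
              (((n : ℝ) + 1) ^ d)⁻¹ * ∑ z : Fin d → Fin (n + 1), ψ y'' (siteOf d ((n + 1) * s) (chart n (windowMap d s yy) z)))⁻¹ y' y''
            * ((((n : ℝ) + 1) ^ d)⁻¹ * ∑ z'' : Fin d → Fin (n + 1), u (siteOf d ((n + 1) * s) (chart n (windowMap d s y'') z''))))
            * ψ y' x| ≤ C * M := by
  classical
  have hdR : (0 : ℝ) ≤ d := Nat.cast_nonneg d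
  have hm0 : 0 < min 2 a - lam := by linarith
  obtain ⟨κ, hκ0, hκ1, hκm⟩ := exists_rate (d := d) a ha.le hm0
  have hm : 0 < min 2 a - lam - 2 * d * κ ^ 2 - a * (exp (2 * d * κ) - 1) := by linarith
  set m := min 2 a - lam - 2 * d * κ ^ 2 - a * (exp (2 * d * κ) - 1) with hm_def
  set Kκ : ℝ := (2 * (1 - exp (-κ))⁻¹) ^ d with hKκ
  have hKκ0 : 0 ≤ Kκ := pow_nonneg (mul_nonneg zero_le_two (inv_nonneg.2 (sub_nonneg.2 (exp_le_one_iff.2 (by linarith))))) d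
  have hminv : 0 ≤ m⁻¹ := inv_nonneg.2 hm.le
  set Cd : ℝ := m⁻¹ * exp (2 * d * κ) * Kκ with hCd
  have hCd0 : 0 ≤ Cd := by positivity
  obtain ⟨C₁, hC₁, H1⟩ := nextScale_inverse_supNorm (d := d) a ha hlam hLam
  obtain ⟨C₀, hC₀, H0⟩ := supNorm_bound_road (d := d) hd a ha hlam hLam
  refine ⟨C₀ * (1 + C₁ * Cd), by positivity, ?_⟩
  intro n s _ V hV hV' ψ hψ M u f hfM hu x
  set T : Matrix (Site d s) (Site d s) ℝ := Matrix.of fun yy y'' : Site d s =>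
    (((n : ℝ) + 1) ^ d)⁻¹ * ∑ z : Fin d → Fin (n + 1), ψ y'' (siteOf d ((n + 1) * s) (chart n (windowMap d s yy) z)) with hT_def
  have hM : 0 ≤ M := (abs_nonneg _).trans (hfM x)
  set mean : Site d s → ℝ := fun y'' =>
    (((n : ℝ) + 1) ^ d)⁻¹ * ∑ z'' : Fin d → Fin (n + 1), u (siteOf d ((n + 1) * s) (chart n (windowMap d s y'') z'')) with hmean_def
  set cc : Site d s → ℝ := fun y' => ∑ y'' : Site d s, T⁻¹ y' y'' * mean y'' with hcc
  set hfl : Site d ((n + 1) * s) → ℝ := fun x => ∑ y' : Site d s, cc y' * ψ y' x with hhfl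
  -- block means of `u` for every source, then the coefficients
  have hmeanb : ∀ y'', |mean y''| ≤ Cd * M := fun y'' => by
    have h := blockMean_le_sup n a s ha.le hκ0 hκ1 hm V hV ψ hψ u f hu hfM y''
    rw [hCd]; exact h
  have hcoef : ∀ y', |cc y'| ≤ C₁ * (Cd * M) := fun y' => H1 n s V hV hV' ψ hψ mean (Cd * M) hmeanb y'
  -- `H hfl = cc∘bt`, so `‖hfl‖_∞ ≤ C₀C₁Cd·M`; `‖u‖_∞ ≤ C₀M`
  have hHfl : ∀ x', ((n : ℝ) + 1) ^ 2 * ∑ μ, (2 * hfl x' - hfl (x' + siteOf d ((n + 1) * s) (e μ)) - hfl (x' - siteOf d ((n + 1) * s) (e μ)))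
      + a / ((n : ℝ) + 1) ^ d * ∑ q ∈ B n (blk n (windowMap d ((n + 1) * s) x')), hfl (siteOf d ((n + 1) * s) q) + V x' * hfl x'
      = cc (siteOf d s (blk n (windowMap d ((n + 1) * s) x'))) := by
    intro x'
    simp only [hhfl]
    rw [action_sum_smul n a s Finset.univ cc ψ V x']
    simp only [hψ, mul_ite, mul_one, mul_zero, Finset.sum_ite_eq, Finset.mem_univ, if_true]
  have h1 := H0 n s V hV hV' (C₁ * (Cd * M)) hfl (fun x' => cc (siteOf d s (blk n (windowMap d ((n + 1) * s) x')))) (fun x' => hcoef _) hHfl x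
  have h2 := H0 n s V hV hV' M u f hfM hu x
  have h3 : |u x - hfl x| ≤ C₀ * M + C₀ * (C₁ * (Cd * M)) := (abs_sub _ _).trans (add_le_add h2 h1)
  simp only [hhfl, hcc, hmean_def] at h3
  refine h3.trans (le_of_eq ?_)
  ring

/-! ## §4. `H_V⁻¹` is Lipschitz in the potential on `ℓ^∞` -/

/-- **`‖H_{V₁}⁻¹f − H_{V₂}⁻¹f‖_∞ ≤ C·‖V₁ − V₂‖_∞·‖f‖_∞` ON THE ROAD'S CLASS, `d ≥ 3`, every mesh, every volume, every source**: for `V₁, V₂ ∈ [−λ, Λ]`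
with `|V₁ − V₂| ≤ D`, `H_{V₁}u₁ = f = H_{V₂}u₂`, `|f| ≤ M`: `|u₁ x − u₂ x| ≤ C·D·M` — (141) `action_sub_of_potentials` (`H_{V₁}(u₁ − u₂) = −(V₁ − V₂)u₂`)
and (152) twice. [folklore] -/
theorem propagator_supNorm_lipschitz (hd : 3 ≤ d) (a : ℝ) (ha : 0 < a) {lam Lam : ℝ} (hlam : lam < min 2 a) (hLam : 0 ≤ Lam) :
    ∃ C : ℝ, 0 < C ∧ ∀ (n s : ℕ) [NeZero s] (V₁ V₂ : Site d ((n + 1) * s) → ℝ), (∀ x, -lam ≤ V₁ x) → (∀ x, V₁ x ≤ Lam) →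
      (∀ x, -lam ≤ V₂ x) → (∀ x, V₂ x ≤ Lam) → ∀ D : ℝ, (∀ x, |V₁ x - V₂ x| ≤ D) →
      ∀ (M : ℝ) (u₁ u₂ f : Site d ((n + 1) * s) → ℝ), (∀ x, |f x| ≤ M) →
      (∀ x, ((n : ℝ) + 1) ^ 2 * ∑ μ, (2 * u₁ x - u₁ (x + siteOf d ((n + 1) * s) (e μ)) - u₁ (x - siteOf d ((n + 1) * s) (e μ)))
        + a / ((n : ℝ) + 1) ^ d * ∑ q ∈ B n (blk n (windowMap d ((n + 1) * s) x)), u₁ (siteOf d ((n + 1) * s) q) + V₁ x * u₁ x = f x) →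
      (∀ x, ((n : ℝ) + 1) ^ 2 * ∑ μ, (2 * u₂ x - u₂ (x + siteOf d ((n + 1) * s) (e μ)) - u₂ (x - siteOf d ((n + 1) * s) (e μ)))
        + a / ((n : ℝ) + 1) ^ d * ∑ q ∈ B n (blk n (windowMap d ((n + 1) * s) x)), u₂ (siteOf d ((n + 1) * s) q) + V₂ x * u₂ x = f x) →
      ∀ x : Site d ((n + 1) * s), |u₁ x - u₂ x| ≤ C * D * M := by
  classical
  obtain ⟨C₀, hC₀, H0⟩ := supNorm_bound_road (d := d) hd a ha hlam hLam
  refine ⟨C₀ * C₀, by positivity, ?_⟩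
  intro n s _ V₁ V₂ hV₁ hV₁' hV₂ hV₂' D hD M u₁ u₂ f hfM hu₁ hu₂ x
  have hM : 0 ≤ M := (abs_nonneg _).trans (hfM x)
  have hD0 : 0 ≤ D := (abs_nonneg _).trans (hD x)
  have hu2 : ∀ x', |u₂ x'| ≤ C₀ * M := H0 n s V₂ hV₂ hV₂' M u₂ f hfM hu₂
  have hsrc : ∀ x', |-((V₁ x' - V₂ x') * u₂ x')| ≤ D * (C₀ * M) := fun x' => by
    rw [abs_neg, abs_mul]; exact mul_le_mul (hD x') (hu2 x') (abs_nonneg _) hD0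
  have hdiff := action_sub_of_potentials n a s V₁ V₂ u₁ u₂ f hu₁ hu₂
  have h := H0 n s V₁ hV₁ hV₁' (D * (C₀ * M)) (fun x' => u₁ x' - u₂ x') (fun x' => -((V₁ x' - V₂ x') * u₂ x')) hsrc hdiff x
  refine h.trans (le_of_eq ?_)
  ring

/-! ## §5. Toy -/

/-- Toy (`d = 3`, `a = 1`, `λ = 0`, `Λ = 1`): the Lipschitz constant of §4 exists. -/
example : ∃ C : ℝ, 0 < C :=
  let ⟨C, hC, _⟩ := propagator_supNorm_lipschitz (d := 3) le_rfl 1 one_pos (lam := 0) (Lam := 1) (by norm_num) zero_le_one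
  ⟨C, hC⟩

end Summit.QuantumFields.BalabanUV.T4Continuum.NE7b.SupTorusSupNormOperators
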